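import Summits.QuantumAdvantage.QuantumAdvantage.Theorems.LinnikCubicClassGroupsDegreeOnePrimesEscapeClassPNTFamilyZeroSumZFR
import Summits.QuantumAdvantage.QuantumAdvantage.Theorems.LinnikCubicClassGroupsDegreeOnePrimesEscapeClassPNTDHInputs
import Summits.QuantumAdvantage.QuantumAdvantage.Theorems.LinnikCubicClassGroupsDegreeOnePrimesEscapeClassPNTDHNumerics
import Summits.QuantumAdvantage.QuantumAdvantage.Theorems.LinnikCubicClassGroupsDegreeOnePrimesEscapeClassPNTSmoothedMain
import Literature.NumberTheory.LFunctions.UniformClassGroupPNTReduction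
import HarnessLib

/-!
# The class prime number theorem with the Deuring–Heilbronn phenomenon, III′: the smoothed class sums,
POINTED at a given exceptional zero

Topic `Summits/QuantumAdvantage/QuantumAdvantage/Theorems`, cell B2b-1 (linnik-cubic), PART A (gen 7);
helper toward the crux `DegreeOnePrimesEscape` (stmt-QuantumAdvantage-11543) of route
`LinnikCubicClassGroups`.  HONEST FRAMING: the value of this file is a THEOREM (kernel-checked,
GRH-free) — NOT summit progress.

`smoothedClassSum_pointed_dh` is the POINTED form of `smoothedClassSum_dichotomy_dh`
(`…ClassPNTDHSmoothed.lean`): the dichotomy there is proved by cases on the existence of a zero of the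
family in the exceptional segment, but its first disjunct does not record that no such zero exists, so
the second disjunct cannot be invoked AT a zero one already knows.  Here the exceptional zero
`(ψ₁, ρ₁)` (a zero of the factor `ψ₁` of `ζ_K ∏ L(s, χ)` with `0 < Re ρ₁ < 1` on the segment
`Im ρ = 0, Re ρ > 1 − c/(log|d_K| + log 4)`) is a HYPOTHESIS, and the conclusion is the two-sided bound
with error `η · x · min(1, (1 − β₁) log x)` at `β₁ = Re ρ₁`, `χ₁ = ψ₁` (plus: `ρ₁` is real and `ψ₁` is a
real character).  The proof is the exceptional branch of the tree's proof, verbatim.  Needed for the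
Chebotarev–Linnik theorem for `S₃`-cubic fields, where the exceptional zero of the sextic closure `N` is
inherited from the quadratic resolvent.
References: J. Thorner, A. Zaman, Algebra Number Theory 13 (2019), Thm. 1.4 / §5 [ThornerZaman2019];
J. C. Lagarias, H. L. Montgomery, A. M. Odlyzko, Invent. Math. 54 (1979), §7 [LagariasMontgomeryOdlyzko1979].
-/

noncomputable section

open Complex Real MeasureTheory Set Filter Topology
open scoped NumberField nonZeroDivisors

namespace Summit.QuantumAdvantage.QuantumAdvantage.Theorems.DegreeOnePrimesEscape

open Literature.NumberTheory.LFunctions Literature.NumberTheory.LFunctions.NumberField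
  Literature.NumberTheory.LFunctions.EntireEF Literature.NumberTheory.LFunctions.TZWeight
  Literature.NumberTheory.LFunctions.AbelianDensity

set_option maxHeartbeats 3200000 in
/-- **The smoothed class sums with the Deuring–Heilbronn phenomenon, pointed at a given exceptional zero**
(see the module docstring). [cite: ThornerZaman2019, Theorem 1.4] [cite: LagariasMontgomeryOdlyzko1979, §7] -/
theorem smoothedClassSum_pointed_dh (n : ℕ) (hn : 1 < n) {b D a : ℝ} (hb : 0 < b) (hD : 0 < D)
    (ha : 1 ≤ a) {η : ℝ} (hη : 0 < η)
    (hDH : ∃ C : ℝ, 0 < C ∧ ∀ (K : Type) [Field K] [NumberField K] (χ₁ : ClassGroup (𝓞 K) →* ℂˣ),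
      χ₁ * χ₁ = 1 → ∀ β₁ : ℝ, 0 < β₁ → β₁ < 1 → classGroupLFunction K χ₁ β₁ = 0 →
      ∀ (χ : ClassGroup (𝓞 K) →* ℂˣ) (ρ : ℂ), classGroupLFunction K χ ρ = 0 → 1 / 2 ≤ ρ.re → ρ ≠ 1 →
        ρ ≠ β₁ →
        Real.log (1 / (C * (Real.log ((NumberField.discr K).natAbs : ℝ) +
            Module.finrank ℚ K * (Real.log (|ρ.im| + 2) + 1)) * (1 - β₁))) /
          (C * (Real.log ((NumberField.discr K).natAbs : ℝ) +
            Module.finrank ℚ K * (Real.log (|ρ.im| + 2) + 1))) ≤ 1 - ρ.re) :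
    ∃ ν a₁ c : ℝ, 0 < ν ∧ ν ≤ 1 / 64 ∧ 1 ≤ a₁ ∧ 0 < c ∧ c ≤ 1 / (8 * ((n : ℝ) ^ 2 + 1)) ∧
    ∀ (K : Type) [Field K] [NumberField K], Module.finrank ℚ K = n →
      (∀ (T : ℝ), 1 ≤ T → ∀ u : AddChar (Additive (ClassGroup (𝓞 K))) ℂ → Finset ℂ,
        (∀ ψ, ∀ ρ ∈ u ψ, famF K ψ ρ = 0 ∧ 1 / 4 ≤ ρ.re ∧ ρ.re < 1 ∧ |ρ.im| ≤ T) →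
        ∀ α : ℝ, α ≤ 1 →
          ∑ ψ, ∑ ρ ∈ u ψ with α ≤ ρ.re, (famMult K ψ ρ : ℝ) ≤
            D * Real.exp (b * (a * Real.log (ThornerZaman.condQn K) + Real.log (T + 4))) ^ (1 - α)) →
      ∀ (ψ₁ : AddChar (Additive (ClassGroup (𝓞 K))) ℂ) (ρ₁ : ℂ), famF K ψ₁ ρ₁ = 0 → 0 < ρ₁.re →
        ρ₁.re < 1 → excRegion c K ρ₁ →
        ρ₁.im = 0 ∧ (toMulHom ψ₁).toHomUnits * (toMulHom ψ₁).toHomUnits = 1 ∧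
          ∀ x : ℝ, ThornerZaman.condQn K ^ a₁ ≤ x → ∀ C : ClassGroup (𝓞 K),
            ‖(NumberField.classNumber K : ℂ) *
                (smoothedPsiClass K C (tzTest (Real.log x) (x ^ (-ν))) : ℂ) -
              fordLaplace (tzTest (Real.log x) (x ^ (-ν))) (-1) +
              ψ₁ (Additive.ofMul C⁻¹) * fordLaplace (tzTest (Real.log x) (x ^ (-ν))) (-(ρ₁.re : ℂ))‖ ≤
            η * x * min 1 ((1 - ρ₁.re) * Real.log x) := by
  classical
  obtain ⟨ν, a₀, A₀, hν0, hν64, ha₀1, hA₀, hZ⟩ := fam_zeroSum_le_local_zfr n hn hb hD ha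
  obtain ⟨c₀, hc₀, hpack⟩ := exists_exceptionalZero_const n
  obtain ⟨Al, hAl0, hAl⟩ := exists_norm_logDeriv_classGroupLFunction_left_le
  obtain ⟨M, hM1, hM⟩ := TZWeight.exists_smoothTransition_deriv_bound
  have hlC := leftLineConst_nonneg
  obtain ⟨C, hC, hDH'⟩ := hDH
  obtain ⟨c₁, hc₁, hc₁1, heff⟩ := Residue.one_sub_realZero_ge_condQn_rpow n hn
  have hn2 : (2 : ℝ) ≤ n := by exact_mod_cast hn
  have hn0 : (0 : ℝ) < n := by linarith
  set c : ℝ := min c₀ (1 / (8 * ((n : ℝ) ^ 2 + 1))) with hcdef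
  have hc : 0 < c := lt_min hc₀ (by positivity)
  have hcc₀ : c ≤ c₀ := min_le_left _ _
  have hcn : c ≤ 1 / (8 * ((n : ℝ) ^ 2 + 1)) := min_le_right _ _
  set CJ : ℝ := 8 * leftLineConst * Al * ((n : ℝ) + 1) * M with hCJ
  have hM0 : 0 ≤ M := by linarith
  have hCJ0 : 0 ≤ CJ := by positivity
  set cu : ℝ := min 1 (min (1 / (6 * C * n)) (η / (32 * A₀ * C ^ 2 * n ^ 2))) with hcu
  have hcu0 : 0 < cu := lt_min one_pos (lt_min (by positivity) (by positivity))
  have hcu1 : cu ≤ 1 := min_le_left _ _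
  have hcuC : cu ≤ 1 / (6 * C * n) := (min_le_right _ _).trans (min_le_left _ _)
  have hcuA : cu ≤ η / (32 * A₀ * C ^ 2 * n ^ 2) := (min_le_right _ _).trans (min_le_right _ _)
  set Λ : ℝ := max 1 (Real.log (8 * A₀ / (η * cu))) with hΛ
  have hΛ0 : 0 ≤ Λ := le_trans zero_le_one (le_max_left _ _)
  set ΛJ : ℝ := (2 + max 0 (Real.log (4 * (A₀ + 1152 + CJ) / (η * c₁)))) / ν with hΛJ
  set Λ₁ : ℝ := 8 * a * C * n with hΛ₁
  set Λ₂ : ℝ := 32 * C * n + 16 * C * n * max 0 (Real.log (1 / (2 * C * n * c₁))) with hΛ₂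
  set Λ₃ : ℝ := 8 * (2 + max 0 (Real.log (8 * A₀ / (η * c₁)))) ^ 2 with hΛ₃
  set a₁ : ℝ := max (max (max a₀ 32) (max (4 * a * Λ / c) (2 * Λ ^ 2 / c)))
    (max (max ΛJ Λ₁) (max Λ₂ Λ₃)) with ha₁
  have ha₁a₀ : a₀ ≤ a₁ := le_trans (le_trans (le_max_left _ _) (le_max_left _ _)) (le_max_left _ _)
  have ha₁32 : (32 : ℝ) ≤ a₁ := le_trans (le_trans (le_max_right _ _) (le_max_left _ _)) (le_max_left _ _)
  have ha₁i : 4 * a * Λ / c ≤ a₁ := le_trans (le_trans (le_max_left _ _) (le_max_right _ _)) (le_max_left _ _)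
  have ha₁i' : 2 * Λ ^ 2 / c ≤ a₁ := le_trans (le_trans (le_max_right _ _) (le_max_right _ _)) (le_max_left _ _)
  have ha₁J : ΛJ ≤ a₁ := le_trans (le_trans (le_max_left _ _) (le_max_left _ _)) (le_max_right _ _)
  have ha₁1' : Λ₁ ≤ a₁ := le_trans (le_trans (le_max_right _ _) (le_max_left _ _)) (le_max_right _ _)
  have ha₁2' : Λ₂ ≤ a₁ := le_trans (le_trans (le_max_left _ _) (le_max_right _ _)) (le_max_right _ _)
  have ha₁3' : Λ₃ ≤ a₁ := le_trans (le_trans (le_max_right _ _) (le_max_right _ _)) (le_max_right _ _)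
  have ha₁1 : (1 : ℝ) ≤ a₁ := by linarith
  refine ⟨ν, a₁, c, hν0, hν64, ha₁1, hc, hcn, fun K _ _ hKn hdens ↦ ?_⟩
  have hK : 1 < Module.finrank ℚ K := by rw [hKn]; exact hn
  set Q : ℝ := ThornerZaman.condQn K with hQ
  have hQ12 : (12 : ℝ) ≤ Q := ThornerZaman.twelve_le_condQn (K := K) hK
  have hQ1 : (1 : ℝ) < Q := by linarith
  have hQ0 : (0 : ℝ) < Q := by linarith
  have hlogQ : 2 ≤ Real.log Q := two_lt_log_twelve.le.trans (Real.log_le_log (by norm_num) hQ12)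
  have hlogQ0 : 0 < Real.log Q := by linarith
  have hhQ : (NumberField.classNumber K : ℝ) ≤ Q ^ 4 := by
    have := ThornerZaman.classNumber_le_condQn_pow (K := K) hK; rw [← hQ] at this; exact this
  have hQm2 : Q ^ (-(2 : ℝ)) ≤ 1 := Real.rpow_le_one_of_one_le_of_nonpos hQ1.le (by norm_num)
  have hQm2' : 0 < Q ^ (-(2 : ℝ)) := Real.rpow_pos_of_pos hQ0 _
  have hQexp2 : Q ^ (-(2 : ℝ)) = Real.exp (-(2 * Real.log Q)) := by
    rw [Real.rpow_def_of_pos hQ0]; ring_nf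
  obtain ⟨hLPreal, hLPuniq, hLPsimple⟩ := hpack K hKn
  have hpack_c : ∀ (χ : ClassGroup (𝓞 K) →* ℂˣ) (ρ : ℂ),
      (((χ = 1 → dedekindZeta₁ K ρ = 0) ∧ (χ ≠ 1 → classGroupLFunction₀ K χ ρ = 0)) ∧
        1 - c / (Real.log ((NumberField.discr K).natAbs : ℝ) + Real.log (|ρ.im| + 4)) < ρ.re) →
        ρ.im = 0 ∧ χ * χ = 1 :=
    fun χ ρ h ↦ hLPreal χ ρ ⟨h.1, lpRegion_mono hcc₀ h.2⟩
  have hexcZ : ∀ ψ ρ, famF K ψ ρ = 0 → excRegion c K ρ →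
      (((toMulHom ψ).toHomUnits = 1 → dedekindZeta₁ K ρ = 0) ∧
        ((toMulHom ψ).toHomUnits ≠ 1 → classGroupLFunction₀ K (toMulHom ψ).toHomUnits ρ = 0)) ∧
        1 - c₀ / (Real.log ((NumberField.discr K).natAbs : ℝ) + Real.log (|ρ.im| + 4)) < ρ.re := by
    intro ψ ρ h0 hexc
    refine ⟨famZ_of_famF_eq_zero ψ h0, lpRegion_mono hcc₀ ?_⟩
    obtain ⟨him, hre⟩ := hexc
    rw [him, abs_zero, zero_add]; exact hre
  have hzfr_c : ∀ (x : ℝ) (ψ : AddChar (Additive (ClassGroup (𝓞 K))) ℂ) (ρ : ℂ), famF K ψ ρ = 0 →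
      1 / 4 ≤ ρ.re → ρ.re < 1 → |ρ.im| ≤ x → ¬ excRegion c K ρ →
        ρ.re ≤ 1 - c / (a * Real.log (ThornerZaman.condQn K) + Real.log (|ρ.im| + 4)) := by
    intro x ψ ρ h0 _ _ _ hexc
    have h1 := re_le_of_not_excRegion hpack_c ψ h0 hexc
    have hdQ : Real.log ((NumberField.discr K).natAbs : ℝ) ≤ a * Real.log Q := by
      have hd0 : (0 : ℝ) < ((NumberField.discr K).natAbs : ℝ) := by
        exact_mod_cast Nat.pos_of_ne_zero (Int.natAbs_ne_zero.2 (NumberField.discr_ne_zero K))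
      have h2 := Real.log_le_log hd0 (natAbs_discr_le_condQn K)
      rw [← hQ] at h2; nlinarith
    have hlog4 : 0 < Real.log (|ρ.im| + 4) := Real.log_pos (by linarith [abs_nonneg ρ.im])
    have hlogd : 0 ≤ Real.log ((NumberField.discr K).natAbs : ℝ) := Real.log_natCast_nonneg _
    have : c / (a * Real.log Q + Real.log (|ρ.im| + 4)) ≤
        c / (Real.log ((NumberField.discr K).natAbs : ℝ) + Real.log (|ρ.im| + 4)) :=
      div_le_div_of_nonneg_left hc.le (by linarith) (by linarith)
    rw [← hQ]; linarith
  have hcore : ∀ x : ℝ, Q ^ a₁ ≤ x → ∀ (Cl : ClassGroup (𝓞 K))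
      (Exc : AddChar (Additive (ClassGroup (𝓞 K))) ℂ → Finset ℂ),
      (∀ ψ, ∀ ρ ∈ Exc ψ, famF K ψ ρ = 0 ∧ 0 < ρ.re ∧ ρ.re < 1) →
      (∀ ψ ρ, famF K ψ ρ = 0 → 0 < ρ.re → ρ.re < 1 → excRegion c K ρ → ρ ∈ Exc ψ) →
      ∀ cZ : ℝ, 0 < cZ →
      (∀ (ψ : AddChar (Additive (ClassGroup (𝓞 K))) ℂ) (ρ : ℂ), famF K ψ ρ = 0 → 1 / 4 ≤ ρ.re →
        ρ.re < 1 → |ρ.im| ≤ x → ¬ excRegion c K ρ →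
          ρ.re ≤ 1 - cZ / (a * Real.log (ThornerZaman.condQn K) + Real.log (|ρ.im| + 4))) →
      ‖(NumberField.classNumber K : ℂ) * (smoothedPsiClass K Cl (tzTest (Real.log x) (x ^ (-ν))) : ℂ) -
          fordLaplace (tzTest (Real.log x) (x ^ (-ν))) (-1) +
          ∑ ψ : AddChar (Additive (ClassGroup (𝓞 K))) ℂ, ψ (Additive.ofMul Cl⁻¹) *
            ∑ ρ ∈ Exc ψ, (famMult K ψ ρ : ℂ) * fordLaplace (tzTest (Real.log x) (x ^ (-ν))) (-ρ)‖ ≤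
        x * (A₀ * (Real.exp (-(cZ * Real.log x / (4 * a * Real.log Q))) +
          Real.exp (-Real.sqrt (cZ * Real.log x / 4)))) + η / 4 * x * (c₁ * Q ^ (-(2 : ℝ))) := by
    intro x hx Cl Exc hExc hExc' cZ hcZ hzfr
    have hxa₀ : Q ^ a₀ ≤ x := le_trans (Real.rpow_le_rpow_of_exponent_le hQ1.le ha₁a₀) hx
    have hxQ : Q ≤ x := by
      have : Q ^ (1 : ℝ) ≤ Q ^ a₁ := Real.rpow_le_rpow_of_exponent_le hQ1.le ha₁1
      rw [Real.rpow_one] at this; linarith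
    have hx1 : 1 < x := by linarith
    have hx0 : 0 < x := by linarith
    set L : ℝ := Real.log x with hL
    have hLQ : a₁ * Real.log Q ≤ L := by
      have := Real.log_le_log (by positivity) hx
      rwa [Real.log_rpow (by linarith)] at this
    have hL2a : 2 * a₁ ≤ L := by nlinarith
    have hL64 : 64 ≤ L := by nlinarith
    have hL0 : 0 < L := by linarith
    have hQexp : Q ≤ Real.exp (L / 8) := by
      refine le_exp_of_log_le (by linarith) ?_
      rw [le_div_iff₀ (by norm_num)]; nlinarith
    set ε : ℝ := x ^ (-ν) with hε
    have hε0 : 0 < ε := Real.rpow_pos_of_pos hx0 _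
    have hε1 : ε ≤ 1 := Real.rpow_le_one_of_one_le_of_nonpos hx1.le (by linarith)
    have hεL : ε < L / 2 := by linarith
    have hεexp : ε = Real.exp (-(ν * L)) := by
      rw [hε, Real.rpow_def_of_pos hx0, ← hL]; ring_nf
    have hBf := hZ c K hKn hdens x hxa₀ cZ hcZ hzfr ε le_rfl hε1
    have hM₀ : ∀ ψ : AddChar (Additive (ClassGroup (𝓞 K))) ℂ,
        (famMult K ψ 0 : ℝ) * (L + ε) ≤ 1152 * Real.exp (L / 4) :=
      fun ψ ↦ famMult_zero_term_le hK ψ (by linarith) hε0.le hε1 hQexp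
    have hJ0 : ‖dzEFRemainder K (tzTest L ε) 0‖ ≤ CJ := by
      have hJ := leftLine_term_le_one hAl0 hAl hM K hK hL0 hε0 hεL hε1 hν64 hεexp hQexp
      rw [hKn] at hJ; rw [hCJ]; exact hJ
    have hJ : ∀ ψ : AddChar (Additive (ClassGroup (𝓞 K))) ℂ, ψ ≠ 0 →
        ‖cgEFRemainder (toMulHom ψ).toHomUnits (tzTest L ε) 0‖ ≤ CJ := by
      intro ψ hψ
      have hJ := leftLine_term_le hAl0 hAl hM K hK (toHomUnits_ne_one hψ) hL0 hε0 hεL hε1 hν64 hεexp hQexp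
      rw [hKn] at hJ; rw [hCJ]; exact hJ
    have hest := norm_classNumber_mul_smoothedPsiClass_sub_le hx1 hε0 hεL Cl Exc hExc hExc' hBf hM₀ hJ0 hJ
    have hjunk : A₀ * x ^ (1 - ν) + (NumberField.classNumber K : ℝ) * (1152 * Real.exp (L / 4) + CJ) ≤
        η / 4 * x * (c₁ * Q ^ (-(2 : ℝ))) :=
      junk_small hA₀ hCJ0 hQ12 hhQ hν0 hν64 hη hc₁ hx ha₁32 (by rw [← hΛJ]; exact ha₁J)
    refine hest.trans ?_
    have e : A₀ * x * (Real.exp (-(cZ * Real.log x / (4 * a * Real.log (ThornerZaman.condQn K)))) +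
        Real.exp (-Real.sqrt (cZ * Real.log x / 4))) + A₀ * x ^ (1 - ν) +
        (NumberField.classNumber K : ℝ) * (1152 * Real.exp (L / 4) + CJ) =
        x * (A₀ * (Real.exp (-(cZ * L / (4 * a * Real.log Q))) + Real.exp (-Real.sqrt (cZ * L / 4)))) +
        (A₀ * x ^ (1 - ν) + (NumberField.classNumber K : ℝ) * (1152 * Real.exp (L / 4) + CJ)) := by
      rw [hQ, hL]; ring
    rw [e]
    linarith
  intro ψ₁ ρ₁ h0₁ hre₁ hre₁' hexc₁
  have hZ₁ := hexcZ ψ₁ ρ₁ h0₁ hexc₁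
  obtain ⟨him₁, hreal₁⟩ := hLPreal _ ρ₁ hZ₁
  set β₁ : ℝ := ρ₁.re with hβ₁
  have hρ₁ : ρ₁ = (β₁ : ℂ) := by
    apply Complex.ext <;> simp [hβ₁, him₁]
  have hmult : famMult K ψ₁ ρ₁ = 1 := by
    obtain ⟨hs1, hs2⟩ := hLPsimple _ ρ₁ hZ₁
    by_cases hψ : ψ₁ = 0
    · subst hψ
      have h := hs1 toHomUnits_toMulHom_zero
      have hne : analyticOrderAt (dedekindZeta₁ K) ρ₁ ≠ ⊤ := by rw [h]; exact ENat.one_ne_top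
      have : (analyticOrderNatAt (dedekindZeta₁ K) ρ₁ : ℕ∞) = 1 := by
        rw [Nat.cast_analyticOrderNatAt hne, h]
      rw [famMult, famF_zero]; exact_mod_cast this
    · have h := hs2 (toHomUnits_ne_one hψ)
      have hne : analyticOrderAt (classGroupLFunction₀ K (toMulHom ψ₁).toHomUnits) ρ₁ ≠ ⊤ := by
        rw [h]; exact ENat.one_ne_top
      have : (analyticOrderNatAt (classGroupLFunction₀ K (toMulHom ψ₁).toHomUnits) ρ₁ : ℕ∞) = 1 := by
        rw [Nat.cast_analyticOrderNatAt hne, h]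
      rw [famMult, famF_of_ne hψ]; exact_mod_cast this
  set χ₁ : ClassGroup (𝓞 K) →* ℂˣ := (toMulHom ψ₁).toHomUnits with hχ₁
  have hβ1 : β₁ < 1 := hre₁'
  have hβhalf : 1 / 2 ≤ β₁ := by
    have hlog4 : 1 < Real.log 4 := by
      rw [show (4:ℝ) = 2 ^ 2 by norm_num, Real.log_pow]; have := Real.log_two_gt_d9; push_cast; linarith
    have hlogd : 0 ≤ Real.log ((NumberField.discr K).natAbs : ℝ) := Real.log_natCast_nonneg _
    have hc2 : c ≤ 1 / 2 :=
      hcn.trans (by rw [div_le_div_iff_of_pos_left one_pos (by positivity) (by norm_num)]; nlinarith)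
    have : c / (Real.log ((NumberField.discr K).natAbs : ℝ) + Real.log 4) ≤ 1 / 2 := by
      rw [div_le_iff₀ (by linarith)]; nlinarith
    linarith [hexc₁.2]
  have hβ0 : 0 < β₁ := by linarith
  have h0β : famF K ψ₁ (β₁ : ℂ) = 0 := by rw [← hρ₁]; exact h0₁
  have hβ1ne : ((β₁ : ℝ) : ℂ) ≠ 1 := by
    intro h'; apply hβ1.ne; exact_mod_cast h'
  have hLzero : classGroupLFunction K χ₁ β₁ = 0 := classGroupLFunction_eq_zero_of_famF ψ₁ h0β hβ1ne
  have hδlow : c₁ * Q ^ (-(2 : ℝ)) ≤ 1 - β₁ := heff K hKn χ₁ hreal₁ β₁ hβ1 hLzero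
  have hexcβ : excRegion c K (β₁ : ℂ) := by rw [← hρ₁]; exact hexc₁
  have hrep := hDH' K χ₁ hreal₁ β₁ hβ0 hβ1 hLzero
  refine ⟨him₁, hreal₁, fun x hx Cl ↦ ?_⟩
  set Exc : AddChar (Additive (ClassGroup (𝓞 K))) ℂ → Finset ℂ :=
    fun ψ ↦ if ψ = ψ₁ then {ρ₁} else ∅ with hExcdef
  have hExc : ∀ ψ, ∀ ρ ∈ Exc ψ, famF K ψ ρ = 0 ∧ 0 < ρ.re ∧ ρ.re < 1 := by
    intro ψ ρ hρ
    rw [hExcdef] at hρ; dsimp only at hρ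
    split_ifs at hρ with hψ
    · rw [Finset.mem_singleton] at hρ; subst hρ; subst hψ; exact ⟨h0₁, hre₁, hre₁'⟩
    · simp at hρ
  have hExc' : ∀ ψ ρ, famF K ψ ρ = 0 → 0 < ρ.re → ρ.re < 1 → excRegion c K ρ → ρ ∈ Exc ψ := by
    intro ψ ρ h0 _ _ hexc
    have hZ := hexcZ ψ ρ h0 hexc
    obtain ⟨hχ, hρρ⟩ := hLPuniq _ _ ρ ρ₁ hZ hZ₁
    have hψ : ψ = ψ₁ := toHomUnits_toMulHom_injective hχ
    rw [hExcdef]; dsimp only; rw [if_pos hψ, Finset.mem_singleton]; exact hρρ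
  have hsum : ∑ ψ : AddChar (Additive (ClassGroup (𝓞 K))) ℂ, ψ (Additive.ofMul Cl⁻¹) *
      ∑ ρ ∈ Exc ψ, (famMult K ψ ρ : ℂ) * fordLaplace (tzTest (Real.log x) (x ^ (-ν))) (-ρ) =
      ψ₁ (Additive.ofMul Cl⁻¹) * fordLaplace (tzTest (Real.log x) (x ^ (-ν))) (-(β₁ : ℂ)) := by
    rw [Finset.sum_eq_single ψ₁]
    · rw [hExcdef]; dsimp only; rw [if_pos rfl, Finset.sum_singleton, hmult, ← hρ₁]; push_cast; ring
    · intro ψ _ hψ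
      rw [hExcdef]; dsimp only; rw [if_neg hψ, Finset.sum_empty, mul_zero]
    · intro h; exact absurd (Finset.mem_univ _) h
  have hxQ : Q ≤ x := by
    have : Q ^ (1 : ℝ) ≤ Q ^ a₁ := Real.rpow_le_rpow_of_exponent_le hQ1.le ha₁1
    rw [Real.rpow_one] at this; linarith
  have hx1 : 1 < x := by linarith
  have hx0 : 0 < x := by linarith
  have hLQ : a₁ * Real.log Q ≤ Real.log x := by
    have := Real.log_le_log (by positivity) hx
    rwa [Real.log_rpow (by linarith)] at this
  have hL2a : 2 * a₁ ≤ Real.log x := by nlinarith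
  have hL64 : 64 ≤ Real.log x := by nlinarith
  have hL1 : 1 ≤ Real.log x := by linarith
  have hL0 : 0 < Real.log x := by linarith
  have hδ₁0 : 0 < 1 - β₁ := by linarith
  have hη₁0 : 0 < (1 - β₁) * Real.log x := mul_pos hδ₁0 hL0
  have hδη : 1 - β₁ ≤ (1 - β₁) * Real.log x := by
    have := mul_le_mul_of_nonneg_left hL1 hδ₁0.le; rw [mul_one] at this; exact this
  have hη₁low : c₁ * Q ^ (-(2 : ℝ)) ≤ (1 - β₁) * Real.log x := hδlow.trans hδη
  have hη₁low1 : c₁ * Q ^ (-(2 : ℝ)) ≤ 1 := (mul_le_mul hc₁1 hQm2 hQm2'.le zero_le_one).trans (by norm_num)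
  have hη₁m : c₁ * Q ^ (-(2 : ℝ)) ≤ min 1 ((1 - β₁) * Real.log x) := le_min hη₁low1 hη₁low
  have hm0 : 0 ≤ min 1 ((1 - β₁) * Real.log x) := le_min zero_le_one hη₁0.le
  have hηxm : 0 ≤ η * x * min 1 ((1 - β₁) * Real.log x) := by positivity
  rcases le_or_gt cu ((1 - β₁) * Real.log x) with hA | hB
  · -- regime A: `(1 − β₁) log x ≥ cu` — the classical zero-free region suffices
    have key := hcore x hx Cl Exc hExc hExc' c hc (hzfr_c x)
    rw [hsum] at key
    have hmcu : cu ≤ min 1 ((1 - β₁) * Real.log x) := le_min hcu1 hA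
    have heΛ : Real.exp (-Λ) ≤ η * cu / (8 * A₀) := by
      refine exp_neg_le_of_neg_log_le (by positivity) ?_
      rw [← Real.log_inv, inv_div]; exact le_max_right _ _
    have hzs := zeroSum_main_small (η := η * cu) hc ha hA₀ hΛ0 hlogQ0 hL0 hLQ hL2a ha₁i ha₁i' heΛ
    have h1 : x * (A₀ * (Real.exp (-(c * Real.log x / (4 * a * Real.log Q))) +
        Real.exp (-Real.sqrt (c * Real.log x / 4)))) ≤ η / 4 * x * min 1 ((1 - β₁) * Real.log x) := by
      calc x * (A₀ * (Real.exp (-(c * Real.log x / (4 * a * Real.log Q))) +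
          Real.exp (-Real.sqrt (c * Real.log x / 4))))
          ≤ x * (η * cu / 4) := mul_le_mul_of_nonneg_left hzs hx0.le
        _ = η / 4 * x * cu := by ring
        _ ≤ η / 4 * x * min 1 ((1 - β₁) * Real.log x) := mul_le_mul_of_nonneg_left hmcu (by positivity)
    have h2 : η / 4 * x * (c₁ * Q ^ (-(2 : ℝ))) ≤ η / 4 * x * min 1 ((1 - β₁) * Real.log x) :=
      mul_le_mul_of_nonneg_left hη₁m (by positivity)
    linarith [key, h1, h2, hηxm]
  · -- regime B: `(1 − β₁) log x < cu` — the Deuring–Heilbronn zero-free region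
    have hη₁1 : (1 - β₁) * Real.log x ≤ 1 := hB.le.trans hcu1
    have hmin : min 1 ((1 - β₁) * Real.log x) = (1 - β₁) * Real.log x := min_eq_right hη₁1
    have hsmall : 2 * C * n * ((1 - β₁) * Real.log x) ≤ 1 / 3 := by
      have h1 : 2 * C * n * ((1 - β₁) * Real.log x) ≤ 2 * C * n * cu :=
        mul_le_mul_of_nonneg_left hB.le (by positivity)
      have h2 : 2 * C * n * cu ≤ 2 * C * n * (1 / (6 * C * n)) :=
        mul_le_mul_of_nonneg_left hcuC (by positivity)
      have h3 : 2 * C * n * (1 / (6 * C * n)) = 1 / 3 := by field_simp; ring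
      linarith
    have hη₁A : (1 - β₁) * Real.log x ≤ η / (32 * A₀ * C ^ 2 * n ^ 2) := hB.le.trans hcuA
    have hL4 : 4 ≤ Real.log x := by linarith
    have hcZ0 : 0 < min (Real.log (1 / (2 * C * n * ((1 - β₁) * Real.log x))) / (C * n))
        (a * Real.log Q / 2) := by
      refine lt_min (div_pos (Real.log_pos ?_) (by positivity)) (by positivity)
      have h0 : 0 < 2 * C * n * ((1 - β₁) * Real.log x) := by positivity
      rw [lt_div_iff₀ h0]; linarith
    have hzfr : ∀ (ψ : AddChar (Additive (ClassGroup (𝓞 K))) ℂ) (ρ : ℂ), famF K ψ ρ = 0 →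
        1 / 4 ≤ ρ.re → ρ.re < 1 → |ρ.im| ≤ x → ¬ excRegion c K ρ →
          ρ.re ≤ 1 - min (Real.log (1 / (2 * C * n * ((1 - β₁) * Real.log x))) / (C * n))
            (a * Real.log Q / 2) / (a * Real.log Q + Real.log (|ρ.im| + 4)) :=
      zfr_of_zeroRepulsion (K := K) hn hKn hC (c := c) (a := a) ha hexcβ hβ1 hxQ hL4 hrep hsmall
    have key := hcore x hx Cl Exc hExc hExc' _ hcZ0 hzfr
    rw [hsum] at key
    have hη₁low' : c₁ * Real.exp (-(2 * Real.log Q)) ≤ (1 - β₁) * Real.log x := by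
      rw [← hQexp2]; exact hη₁low
    have hzs := dhRegime_zeroSum_small (A₀ := A₀) (C := C) (n := (n : ℝ)) (η := η)
      (η₁ := (1 - β₁) * Real.log x) (c₁ := c₁) (a := a) (lQ := Real.log Q) (L := Real.log x) (a₁ := a₁)
      hA₀ hC hn2 hη hc₁ ha (by linarith) hη₁0 hη₁low' hsmall hη₁A hLQ
      (by rw [← hΛ₁]; exact ha₁1') (by rw [← hΛ₂]; exact ha₁2') (by rw [← hΛ₃]; exact ha₁3')
    have h1 : x * (A₀ * (Real.exp (-(min (Real.log (1 / (2 * C * n * ((1 - β₁) * Real.log x))) / (C * n))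
        (a * Real.log Q / 2) * Real.log x / (4 * a * Real.log Q))) +
        Real.exp (-Real.sqrt (min (Real.log (1 / (2 * C * n * ((1 - β₁) * Real.log x))) / (C * n))
        (a * Real.log Q / 2) * Real.log x / 4)))) ≤ η / 4 * x * ((1 - β₁) * Real.log x) := by
      calc _ ≤ x * (η / 4 * ((1 - β₁) * Real.log x)) := mul_le_mul_of_nonneg_left hzs hx0.le
        _ = η / 4 * x * ((1 - β₁) * Real.log x) := by ring
    have h2 : η / 4 * x * (c₁ * Q ^ (-(2 : ℝ))) ≤ η / 4 * x * ((1 - β₁) * Real.log x) :=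
      mul_le_mul_of_nonneg_left hη₁low (by positivity)
    rw [hmin]
    have hpos : 0 ≤ η * x * ((1 - β₁) * Real.log x) := by positivity
    linarith [key, h1, h2, hpos]
end Summit.QuantumAdvantage.QuantumAdvantage.Theorems.DegreeOnePrimesEscape

end
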